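import Summits.QuantumFields.BalabanUV.Beta.GAN24.WoodburyFibreProjector

/-!
# `BalabanUV.Beta.D1BFx.ProjectorJet` — road «BF-x» for binder row D1, leaf J5 (MODEL LEVEL): the FIRST-ORDER BACKGROUND JET
# of Bałaban's gauge coprojector `R = coproj X` along a variation of its column family `X`, its Leibniz characterisation
# WITH UNIQUENESS, its off-diagonality, and the [B9] (3.25) instance `X = G′·Q′ᴴ`

HONEST FRAMING (cell contract, verbatim): «discharging `BetaPertH` makes Bałaban's UV stability UNCONDITIONAL — a real
constructive-QFT result; it is NOT the continuum limit and NOT the Clay problem.»  HONEST DEPENDENCY (verbatim): «continuum YM on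
T⁴ ⇐ BetaPertH ∧ nine spine estimates (0/9 proved); BetaPertH ⇐ (D1) ∧ (D4) ∧ CAP+tail; G-an2-4 gates asym, D1 and NE2/3/4.»
This module is [folklore] finite-dimensional matrix algebra over a field with a star (Mathlib `Matrix`, `conjTranspose`,
`nonsing_inv`), composed BY NAME with lineage gan24-p3's coprojector API (`GAN24.WoodburyFibreGaugeSection.coproj`,
`conjTranspose_mul_coproj`, `coproj_mul_self`, `coproj_conjTranspose`, `coproj_mul_coproj`, `gram_conjTranspose`).  It cites
nothing as a hypothesis, mints no `Prop`, discharges nothing of the wall; 0 binders of row D1 are instantiated; NOT D1, NOT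
BetaPertH, NOT continuum, NOT Clay.

WHY (skeleton `HOME/beta/skeletons/D1-b2b-balaban-beta-d1-p2.md` v1.4 node J, leaf J5 «GAUGE-TERM jets `∂_A(D_A R_A D_A*)|₀`»;
typer spec `TYPER-SPEC-D1BFx.md` §3; leaf-09-g2's reading note `CHECK-K-R2.md` §6).  In the background-Feynman representation of road
BF-x the gauge term of the one-step action is `½‖R_U D_U* A‖² = ½⟨A, D_U R_U D_U* A⟩`, where — PRINT LOCATOR, orientation only, NOT a
hypothesis — [B9] = T. Bałaban, *Propagators for lattice gauge theories in a background field*, Commun. Math. Phys. **99** (1985),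
p. 394 (3.21) «R = R(U) is an orthogonal projection … onto the subspace ℛ = Δ_U N(Q′)», (3.25) «Rf = (I − G′Q′*(Q′G′²Q′*)⁻¹Q′G′)f,
where G′ = G′(U) = (Δ′_a)⁻¹».  At the MODEL level (finite index types) this is gan24-p3's `coproj X = 1 − X(XᴴX)⁻¹Xᴴ` at the column
family `X = G′Q′ᴴ` (`WoodburyFibreProjector.coproj_minimiser_eq_balaban325`).  Leaf J5 needs the FIRST-ORDER JET of `R(U)` in the
background: both `G′_U` and `Q′(U)` move with `U`, hence so does the column family `X_U`.  This file records, once and for all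
column variations `Ẋ`, what that jet IS and how to RECOGNISE it:

* [our object] `pinv X := (XᴴX)⁻¹Xᴴ` (the left pseudo-inverse; `pinv X · X = 1`, `X · pinv X = 1 − coproj X`);
* [our object] `cojet X Ẋ := −(coproj X · Ẋ · pinv X + (coproj X · Ẋ · pinv X)ᴴ)` — THE JET;
* LEIBNIZ CHARACTERISATION (§3): `cojet X Ẋ` is Hermitian, `R·Ṙ + Ṙ·R = Ṙ` (the jet of `R² = R`), `Ṙ·X + R·Ẋ = 0` (the jet of
  `R·X = 0`), and **`cojet_unique`**: ANY `Z` with these three properties equals `cojet X Ẋ`.  This is the SOCKET for the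
  kernel-level leaf (J5 proper): a candidate `ℤ⁴` kernel for the jet of `R` is THE jet iff it passes these three identities against
  the typed `U = 1` objects (leaf-09-g2's `D1BFx.RProjector.Pker = 1 − R`, the typed column variation);
* OFF-DIAGONALITY (§3): `R·Ṙ·R = 0` and `P·Ṙ·P = 0` (`P := 1 − R = X·pinv X`) — every term of the jet carries EXACTLY ONE factor from
  the block-structured side {`P`, `pinv X`} (skeleton J5: «block part → A3») and none is `R·(…)·R`;
* THE B9 INSTANCE (§4): for `X = H⁻¹Qᴴ` with `H`, `V` Hermitian and column variation `Ẋ = −H⁻¹·V·X + H⁻¹·Q̇ᴴ` (resolvent identity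
  for `Ġ′ = −G′ḢG′`, `Ḣ = V`, plus the motion `Q̇` of the constraint):
  **`Ṙ = R·H⁻¹·V·P + P·V·H⁻¹·R − (R·H⁻¹·Q̇ᴴ·pinv X + (R·H⁻¹·Q̇ᴴ·pinv X)ᴴ)`**, `pinv X = (QH⁻¹H⁻¹Qᴴ)⁻¹·Q·H⁻¹`.
  READING for the road (asserted nowhere below): at `U = 1`, `H⁻¹ = G′` is the typer's T2 `GhostLeg.Ggh`, `V` the ghost-kinetic jet
  plus `a·∂(Q′ᴴQ′)` (T6 `ghCur`, `qAnti`), `Q̇` the averaging jet (T6 `qJet`), `(QH⁻²Qᴴ)⁻¹` pv23's `B6QGGQ278Zd.Csq`; and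
  `∂(D·R·D*) = Ḋ·R·D* + D·R·Ḋ* + D·Ṙ·D*`.

The CALCULUS reading over `ℝ` (if `t ↦ X t` has derivative `Ẋ` and `XᴴX` is a unit then `t ↦ coproj (X t)` has derivative
`cojet X Ẋ`) is the sequel `D1BFx/ProjectorJetDeriv`; here everything is exact algebra over any field with a star.
-/

namespace Summit.QuantumFields.BalabanUV.Beta.D1BFx.ProjectorJet

open Matrix
open Summit.QuantumFields.BalabanUV.Beta.GAN24.WoodburyFibreGaugeSection
  (coproj gram_conjTranspose conjTranspose_mul_coproj coproj_mul_self coproj_conjTranspose coproj_mul_coproj)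
open Summit.QuantumFields.BalabanUV.Beta.GAN24.WoodburyFibreProjector (coproj_mul_unit)

section Algebra

variable {𝕜 : Type*} [Field 𝕜] [StarRing 𝕜]
variable {m n : Type*} [Fintype m] [Fintype n] [DecidableEq m] [DecidableEq n]

/-! ## §1 The left pseudo-inverse of a column family -/

/-- [our object] The LEFT PSEUDO-INVERSE `X⁺ := (XᴴX)⁻¹Xᴴ` of a column family `X` (meaningful when the Gram matrix `XᴴX` is a
unit). -/
noncomputable def pinv (X : Matrix n m 𝕜) : Matrix m n 𝕜 := (Xᴴ * X)⁻¹ * Xᴴ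

omit [DecidableEq n] in
/-- [our object] Unfolding. -/
theorem pinv_def (X : Matrix n m 𝕜) : pinv X = (Xᴴ * X)⁻¹ * Xᴴ := rfl

omit [DecidableEq n] in
/-- [folklore] `X⁺ · X = 1`. -/
theorem pinv_mul_self {X : Matrix n m 𝕜} (hG : IsUnit (Xᴴ * X)) : pinv X * X = 1 := by
  rw [pinv, Matrix.mul_assoc, nonsing_inv_mul _ ((isUnit_iff_isUnit_det _).mp hG)]

/-- [folklore] `1 − X · X⁺ = coproj X` (so `X · X⁺ = P := 1 − R`, the projector ONTO the columns). -/
theorem one_sub_self_mul_pinv (X : Matrix n m 𝕜) : 1 - X * pinv X = coproj X := by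
  rw [pinv, ← Matrix.mul_assoc]; rfl

/-- [folklore] `X · X⁺ = 1 − coproj X`. -/
theorem self_mul_pinv (X : Matrix n m 𝕜) : X * pinv X = 1 - coproj X := by
  rw [← one_sub_self_mul_pinv, sub_sub_cancel]

omit [DecidableEq n] in
/-- [folklore] `(X⁺)ᴴ = X · (XᴴX)⁻¹` (the Gram matrix is Hermitian). -/
theorem pinv_conjTranspose (X : Matrix n m 𝕜) : (pinv X)ᴴ = X * (Xᴴ * X)⁻¹ := by
  rw [pinv, conjTranspose_mul, conjTranspose_conjTranspose, conjTranspose_nonsing_inv, gram_conjTranspose]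

/-- [folklore] `X⁺ · R = 0`. -/
theorem pinv_mul_coproj {X : Matrix n m 𝕜} (hG : IsUnit (Xᴴ * X)) : pinv X * coproj X = 0 := by
  rw [pinv, Matrix.mul_assoc, conjTranspose_mul_coproj hG, Matrix.mul_zero]

/-- [folklore] `R · (X⁺)ᴴ = 0`. -/
theorem coproj_mul_pinv_conjTranspose {X : Matrix n m 𝕜} (hG : IsUnit (Xᴴ * X)) : coproj X * (pinv X)ᴴ = 0 := by
  have h := congrArg conjTranspose (pinv_mul_coproj hG)
  rwa [conjTranspose_mul, coproj_conjTranspose, conjTranspose_zero] at h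

/-- [folklore] `R · P = 0` in the form `R · (X · X⁺) = 0`. -/
theorem coproj_mul_self_mul_pinv {X : Matrix n m 𝕜} (hG : IsUnit (Xᴴ * X)) : coproj X * (X * pinv X) = 0 := by
  rw [← Matrix.mul_assoc, coproj_mul_self hG, Matrix.zero_mul]

/-- [folklore] `P · R = 0` in the form `(X · X⁺) · R = 0`. -/
theorem self_mul_pinv_mul_coproj {X : Matrix n m 𝕜} (hG : IsUnit (Xᴴ * X)) : X * pinv X * coproj X = 0 := by
  rw [Matrix.mul_assoc, pinv_mul_coproj hG, Matrix.mul_zero]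

/-! ## §2 The jet and its one-sided products -/

/-- [our object] **THE FIRST-ORDER JET OF THE COPROJECTOR** along a column variation `Ẋ = Y`:
`cojet X Y := −(R · Y · X⁺ + (R · Y · X⁺)ᴴ)`, `R = coproj X`, `X⁺ = pinv X`. -/
noncomputable def cojet (X Y : Matrix n m 𝕜) : Matrix n n 𝕜 := -(coproj X * Y * pinv X + (coproj X * Y * pinv X)ᴴ)

/-- [our object] Unfolding. -/
theorem cojet_def (X Y : Matrix n m 𝕜) : cojet X Y = -(coproj X * Y * pinv X + (coproj X * Y * pinv X)ᴴ) := rfl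

/-- [folklore] The jet is Hermitian (the jet of `Rᴴ = R`). -/
theorem cojet_conjTranspose (X Y : Matrix n m 𝕜) : (cojet X Y)ᴴ = cojet X Y := by
  rw [cojet, conjTranspose_neg, conjTranspose_add, conjTranspose_conjTranspose, add_comm]

/-- [folklore] The jet is additive in the variation. -/
theorem cojet_add (X Y Y' : Matrix n m 𝕜) : cojet X (Y + Y') = cojet X Y + cojet X Y' := by
  simp only [cojet, Matrix.mul_add, Matrix.add_mul, conjTranspose_add]
  abel

/-- [folklore] The jet is homogeneous in the variation (for a self-adjoint scalar). -/
theorem cojet_neg (X Y : Matrix n m 𝕜) : cojet X (-Y) = -cojet X Y := by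
  simp only [cojet, Matrix.mul_neg, Matrix.neg_mul, conjTranspose_neg]
  abel

/-- [folklore] `R · (R·Y·X⁺) = R·Y·X⁺`. -/
theorem coproj_mul_term {X : Matrix n m 𝕜} (hG : IsUnit (Xᴴ * X)) (Y : Matrix n m 𝕜) :
    coproj X * (coproj X * Y * pinv X) = coproj X * Y * pinv X := by
  rw [← Matrix.mul_assoc, ← Matrix.mul_assoc, coproj_mul_coproj hG]

/-- [folklore] `R · (R·Y·X⁺)ᴴ = 0`. -/
theorem coproj_mul_term_conjTranspose {X : Matrix n m 𝕜} (hG : IsUnit (Xᴴ * X)) (Y : Matrix n m 𝕜) :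
    coproj X * (coproj X * Y * pinv X)ᴴ = 0 := by
  rw [conjTranspose_mul, conjTranspose_mul, ← Matrix.mul_assoc, ← Matrix.mul_assoc, coproj_mul_pinv_conjTranspose hG,
    Matrix.zero_mul, Matrix.zero_mul]

/-- [folklore] `(R·Y·X⁺) · R = 0`. -/
theorem term_mul_coproj {X : Matrix n m 𝕜} (hG : IsUnit (Xᴴ * X)) (Y : Matrix n m 𝕜) :
    coproj X * Y * pinv X * coproj X = 0 := by
  rw [Matrix.mul_assoc, pinv_mul_coproj hG, Matrix.mul_zero]

/-- [folklore] `(R·Y·X⁺)ᴴ · R = (R·Y·X⁺)ᴴ`. -/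
theorem term_conjTranspose_mul_coproj {X : Matrix n m 𝕜} (hG : IsUnit (Xᴴ * X)) (Y : Matrix n m 𝕜) :
    (coproj X * Y * pinv X)ᴴ * coproj X = (coproj X * Y * pinv X)ᴴ := by
  have h := congrArg conjTranspose (coproj_mul_term hG Y)
  rwa [conjTranspose_mul, coproj_conjTranspose] at h

/-- [folklore] `(R·Y·X⁺) · X = R·Y`. -/
theorem term_mul_self {X : Matrix n m 𝕜} (hG : IsUnit (Xᴴ * X)) (Y : Matrix n m 𝕜) :
    coproj X * Y * pinv X * X = coproj X * Y := by
  rw [Matrix.mul_assoc, pinv_mul_self hG, Matrix.mul_one]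

/-- [folklore] `(R·Y·X⁺)ᴴ · X = 0`. -/
theorem term_conjTranspose_mul_self {X : Matrix n m 𝕜} (hG : IsUnit (Xᴴ * X)) (Y : Matrix n m 𝕜) :
    (coproj X * Y * pinv X)ᴴ * X = 0 := by
  rw [conjTranspose_mul, conjTranspose_mul, Matrix.mul_assoc, Matrix.mul_assoc, coproj_conjTranspose, coproj_mul_self hG,
    Matrix.mul_zero, Matrix.mul_zero]

/-- [folklore] `R · Ṙ = −R·Ẋ·X⁺`. -/
theorem coproj_mul_cojet {X : Matrix n m 𝕜} (hG : IsUnit (Xᴴ * X)) (Y : Matrix n m 𝕜) :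
    coproj X * cojet X Y = -(coproj X * Y * pinv X) := by
  rw [cojet, Matrix.mul_neg, Matrix.mul_add, coproj_mul_term hG, coproj_mul_term_conjTranspose hG, add_zero]

/-- [folklore] `Ṙ · R = −(R·Ẋ·X⁺)ᴴ`. -/
theorem cojet_mul_coproj {X : Matrix n m 𝕜} (hG : IsUnit (Xᴴ * X)) (Y : Matrix n m 𝕜) :
    cojet X Y * coproj X = -(coproj X * Y * pinv X)ᴴ := by
  rw [cojet, Matrix.neg_mul, Matrix.add_mul, term_mul_coproj hG, term_conjTranspose_mul_coproj hG, zero_add]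

/-! ## §3 The Leibniz characterisation, uniqueness, off-diagonality -/

/-- [folklore] **LEIBNIZ FOR `R² = R`**: `R · Ṙ + Ṙ · R = Ṙ`. -/
theorem coproj_mul_cojet_add_cojet_mul_coproj {X : Matrix n m 𝕜} (hG : IsUnit (Xᴴ * X)) (Y : Matrix n m 𝕜) :
    coproj X * cojet X Y + cojet X Y * coproj X = cojet X Y := by
  rw [coproj_mul_cojet hG, cojet_mul_coproj hG, cojet, neg_add]

/-- [folklore] **LEIBNIZ FOR `R · X = 0`**: `Ṙ · X + R · Ẋ = 0`. -/
theorem cojet_mul_self_add {X : Matrix n m 𝕜} (hG : IsUnit (Xᴴ * X)) (Y : Matrix n m 𝕜) :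
    cojet X Y * X + coproj X * Y = 0 := by
  rw [cojet, Matrix.neg_mul, Matrix.add_mul, term_mul_self hG, term_conjTranspose_mul_self hG, add_zero, neg_add_cancel]

/-- [folklore] **LEIBNIZ FOR `Xᴴ · R = 0`**: `Ẋᴴ · R + Xᴴ · Ṙ = 0`. -/
theorem conjTranspose_mul_cojet_add {X : Matrix n m 𝕜} (hG : IsUnit (Xᴴ * X)) (Y : Matrix n m 𝕜) :
    Yᴴ * coproj X + Xᴴ * cojet X Y = 0 := by
  have h := congrArg conjTranspose (cojet_mul_self_add hG Y)
  rwa [conjTranspose_add, conjTranspose_mul, conjTranspose_mul, cojet_conjTranspose, coproj_conjTranspose, conjTranspose_zero,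
    add_comm] at h

/-- [folklore] **OFF-DIAGONALITY, `R`-corner**: `R · Ṙ · R = 0`. -/
theorem coproj_mul_cojet_mul_coproj {X : Matrix n m 𝕜} (hG : IsUnit (Xᴴ * X)) (Y : Matrix n m 𝕜) :
    coproj X * cojet X Y * coproj X = 0 := by
  rw [coproj_mul_cojet hG, Matrix.neg_mul, term_mul_coproj hG, neg_zero]

/-- [folklore] **OFF-DIAGONALITY, `P`-corner**: `(1 − R) · Ṙ · (1 − R) = 0`. -/
theorem proj_mul_cojet_mul_proj {X : Matrix n m 𝕜} (hG : IsUnit (Xᴴ * X)) (Y : Matrix n m 𝕜) :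
    (1 - coproj X) * cojet X Y * (1 - coproj X) = 0 := by
  have e : (1 - coproj X) * cojet X Y * (1 - coproj X) =
      cojet X Y - coproj X * cojet X Y - cojet X Y * coproj X + coproj X * cojet X Y * coproj X := by
    noncomm_ring
  rw [e, coproj_mul_cojet_mul_coproj hG, coproj_mul_cojet hG, cojet_mul_coproj hG, cojet_def]
  abel

/-- [folklore] The jet splits into its two off-diagonal corners: `Ṙ = R·Ṙ·P + P·Ṙ·R` with `P = 1 − R`. -/
theorem cojet_eq_corners {X : Matrix n m 𝕜} (hG : IsUnit (Xᴴ * X)) (Y : Matrix n m 𝕜) :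
    cojet X Y = coproj X * cojet X Y * (1 - coproj X) + (1 - coproj X) * cojet X Y * coproj X := by
  symm
  calc coproj X * cojet X Y * (1 - coproj X) + (1 - coproj X) * cojet X Y * coproj X
      = (coproj X * cojet X Y - coproj X * cojet X Y * coproj X) + (cojet X Y * coproj X - coproj X * cojet X Y * coproj X) := by
        noncomm_ring
    _ = coproj X * cojet X Y + cojet X Y * coproj X := by rw [coproj_mul_cojet_mul_coproj hG, sub_zero, sub_zero]
    _ = cojet X Y := coproj_mul_cojet_add_cojet_mul_coproj hG Y

/-- [folklore] The `R·(…)·P` corner is `−R·Ẋ·X⁺`. -/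
theorem coproj_mul_cojet_mul_proj {X : Matrix n m 𝕜} (hG : IsUnit (Xᴴ * X)) (Y : Matrix n m 𝕜) :
    coproj X * cojet X Y * (1 - coproj X) = -(coproj X * Y * pinv X) := by
  rw [Matrix.mul_sub, Matrix.mul_one, coproj_mul_cojet_mul_coproj hG, sub_zero, coproj_mul_cojet hG]

/-- [folklore] **UNIQUENESS OF THE JET.**  A matrix `Z` that is Hermitian, satisfies Leibniz for `R² = R` (`R·Z + Z·R = Z`) and
Leibniz for `R·X = 0` against the column variation `Y` (`Z·X + R·Y = 0`) IS `cojet X Y` — no invertibility hypothesis needed.  (From the third identity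
`Z·(X·X⁺) = −R·Y·X⁺`, i.e. `Z·R = Z + R·Y·X⁺`; conjugating, `R·Z = Z + (R·Y·X⁺)ᴴ`; adding and using the second identity,
`Z = 2Z + R·Y·X⁺ + (R·Y·X⁺)ᴴ`.) -/
theorem cojet_unique {X Y : Matrix n m 𝕜} {Z : Matrix n n 𝕜} (hZh : Zᴴ = Z)
    (hZR : coproj X * Z + Z * coproj X = Z) (hZX : Z * X + coproj X * Y = 0) : Z = cojet X Y := by
  set T := coproj X * Y * pinv X with hT
  have h0 : Z * X = -(coproj X * Y) := eq_neg_of_add_eq_zero_left hZX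
  have h1 : Z - Z * coproj X = -T := by
    calc Z - Z * coproj X = Z * (1 - coproj X) := by rw [Matrix.mul_sub, Matrix.mul_one]
      _ = Z * X * pinv X := by rw [← self_mul_pinv, Matrix.mul_assoc]
      _ = -T := by rw [h0, Matrix.neg_mul]
  have h2 : Z * coproj X = Z + T := by
    rw [← sub_sub_cancel Z (Z * coproj X), h1, sub_neg_eq_add]
  have h3 : coproj X * Z = Z + Tᴴ := by
    have h := congrArg conjTranspose h2
    rwa [conjTranspose_mul, coproj_conjTranspose, hZh, conjTranspose_add, hZh] at h
  have h4 : Z = Z + Tᴴ + (Z + T) := by rw [← h3, ← h2]; exact hZR.symm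
  have h5 : Z + (T + Tᴴ) = 0 := by
    calc Z + (T + Tᴴ) = (Z + Tᴴ + (Z + T)) - Z := by abel
      _ = Z - Z := by rw [← h4]
      _ = 0 := sub_self Z
  rw [cojet, ← hT]
  exact eq_neg_of_add_eq_zero_left h5

/-- [folklore] Uniqueness in `iff` form: the three Leibniz identities CHARACTERISE the jet. -/
theorem eq_cojet_iff {X : Matrix n m 𝕜} (hG : IsUnit (Xᴴ * X)) (Y : Matrix n m 𝕜) (Z : Matrix n n 𝕜) :
    Z = cojet X Y ↔ Zᴴ = Z ∧ coproj X * Z + Z * coproj X = Z ∧ Z * X + coproj X * Y = 0 := by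
  constructor
  · rintro rfl
    exact ⟨cojet_conjTranspose X Y, coproj_mul_cojet_add_cojet_mul_coproj hG Y, cojet_mul_self_add hG Y⟩
  · rintro ⟨h1, h2, h3⟩
    exact cojet_unique h1 h2 h3

/-- [folklore] **GAUGE OF THE COLUMNS**: re-mixing the columns by a unit `A` (`X ↦ X·A`, variation `Ẋ ↦ Ẋ·A + X·Ȧ`) changes
neither the coprojector (gan24-p3's `coproj_mul_unit`) nor its jet — only the column SPACE and its motion matter. -/
theorem cojet_mul_unit {X : Matrix n m 𝕜} (hG : IsUnit (Xᴴ * X)) (Y : Matrix n m 𝕜) {A : Matrix m m 𝕜} (hA : IsUnit A)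
    (A' : Matrix m m 𝕜) : cojet (X * A) (Y * A + X * A') = cojet X Y := by
  have hR : coproj (X * A) = coproj X := coproj_mul_unit X hA
  symm
  refine cojet_unique (cojet_conjTranspose X Y) ?_ ?_
  · rw [hR]; exact coproj_mul_cojet_add_cojet_mul_coproj hG Y
  · rw [hR, Matrix.mul_add, ← Matrix.mul_assoc (coproj X) X A', coproj_mul_self hG, Matrix.zero_mul, add_zero,
      ← Matrix.mul_assoc, ← Matrix.mul_assoc, ← Matrix.add_mul, cojet_mul_self_add hG, Matrix.zero_mul]

/-! ## §4 The [B9] (3.25) instance: `X = H⁻¹·Qᴴ`, moving form `Ḣ = V` and moving constraint `Q̇` -/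

/-- [folklore] For the column family `X = H⁻¹Qᴴ`: `H⁻¹·Qᴴ·X⁺ = 1 − R` (`= P`, the rank-`#blocks` projector onto the columns). -/
theorem inv_mul_conjTranspose_mul_pinv (H : Matrix n n 𝕜) (Q : Matrix m n 𝕜) :
    H⁻¹ * Qᴴ * pinv (H⁻¹ * Qᴴ) = 1 - coproj (H⁻¹ * Qᴴ) :=
  self_mul_pinv _

/-- [folklore] **THE JET OF BAŁABAN'S `R` ALONG `(Ḣ, Q̇) = (V, Q̇)`.**  With `X = H⁻¹Qᴴ`, `R = coproj X`, `P = 1 − R` and the column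
variation `Ẋ = −H⁻¹·V·X + H⁻¹·Q̇ᴴ` (first-order resolvent identity `(H⁻¹)˙ = −H⁻¹ḢH⁻¹` — cf. `PropagatorWoodburyFibre.inv_sub_inv_eq`
for its exact form — and the motion of the constraint):
`Ṙ = R·H⁻¹·V·P + (R·H⁻¹·V·P)ᴴ − (R·H⁻¹·Q̇ᴴ·X⁺ + (R·H⁻¹·Q̇ᴴ·X⁺)ᴴ)`. -/
theorem cojet_balaban (H V : Matrix n n 𝕜) (Q Q' : Matrix m n 𝕜) :
    cojet (H⁻¹ * Qᴴ) (-(H⁻¹ * V * (H⁻¹ * Qᴴ)) + H⁻¹ * Q'ᴴ) =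
      coproj (H⁻¹ * Qᴴ) * H⁻¹ * V * (1 - coproj (H⁻¹ * Qᴴ)) + (coproj (H⁻¹ * Qᴴ) * H⁻¹ * V * (1 - coproj (H⁻¹ * Qᴴ)))ᴴ -
        (coproj (H⁻¹ * Qᴴ) * H⁻¹ * Q'ᴴ * pinv (H⁻¹ * Qᴴ) + (coproj (H⁻¹ * Qᴴ) * H⁻¹ * Q'ᴴ * pinv (H⁻¹ * Qᴴ))ᴴ) := by
  set X := H⁻¹ * Qᴴ with hX
  have hP : 1 - coproj X = X * pinv X := (self_mul_pinv X).symm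
  have e1 : coproj X * (-(H⁻¹ * V * X) + H⁻¹ * Q'ᴴ) * pinv X =
      -(coproj X * H⁻¹ * V * (1 - coproj X)) + coproj X * H⁻¹ * Q'ᴴ * pinv X := by
    rw [hP]; simp only [Matrix.mul_add, Matrix.add_mul, Matrix.mul_neg, Matrix.neg_mul, Matrix.mul_assoc]
  rw [cojet, e1, conjTranspose_add, conjTranspose_neg]
  abel

/-- [folklore] The same with `H` and `V` Hermitian: the `V`-corner's adjoint is `P·V·H⁻¹·R`, so
`Ṙ = R·H⁻¹·V·P + P·V·H⁻¹·R − (R·H⁻¹·Q̇ᴴ·X⁺ + (R·H⁻¹·Q̇ᴴ·X⁺)ᴴ)`. -/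
theorem cojet_balaban_of_isHermitian {H V : Matrix n n 𝕜} (hH : H.IsHermitian) (hV : V.IsHermitian) (Q Q' : Matrix m n 𝕜) :
    cojet (H⁻¹ * Qᴴ) (-(H⁻¹ * V * (H⁻¹ * Qᴴ)) + H⁻¹ * Q'ᴴ) =
      coproj (H⁻¹ * Qᴴ) * H⁻¹ * V * (1 - coproj (H⁻¹ * Qᴴ)) + (1 - coproj (H⁻¹ * Qᴴ)) * V * H⁻¹ * coproj (H⁻¹ * Qᴴ) -
        (coproj (H⁻¹ * Qᴴ) * H⁻¹ * Q'ᴴ * pinv (H⁻¹ * Qᴴ) + (coproj (H⁻¹ * Qᴴ) * H⁻¹ * Q'ᴴ * pinv (H⁻¹ * Qᴴ))ᴴ) := by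
  have hHi : (H⁻¹)ᴴ = H⁻¹ := by rw [conjTranspose_nonsing_inv, hH.eq]
  have hadj : (coproj (H⁻¹ * Qᴴ) * H⁻¹ * V * (1 - coproj (H⁻¹ * Qᴴ)))ᴴ =
      (1 - coproj (H⁻¹ * Qᴴ)) * V * H⁻¹ * coproj (H⁻¹ * Qᴴ) := by
    rw [conjTranspose_mul, conjTranspose_mul, conjTranspose_mul, conjTranspose_sub, conjTranspose_one, coproj_conjTranspose, hHi,
      hV.eq, Matrix.mul_assoc, Matrix.mul_assoc]
  rw [cojet_balaban, hadj]

/-- [folklore] **WHERE THE PIECES OF (3.25) SIT**: for `X = H⁻¹Qᴴ` with `H` Hermitian, the pseudo-inverse is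
`X⁺ = (Q·H⁻¹·H⁻¹·Qᴴ)⁻¹ · Q · H⁻¹` — the coarse inverse `(Q′G′²Q′*)⁻¹` of [B9] (3.25) followed by `Q′G′`. -/
theorem pinv_balaban {H : Matrix n n 𝕜} (hH : H.IsHermitian) (Q : Matrix m n 𝕜) :
    pinv (H⁻¹ * Qᴴ) = (Q * H⁻¹ * H⁻¹ * Qᴴ)⁻¹ * Q * H⁻¹ := by
  have hHi : (H⁻¹)ᴴ = H⁻¹ := by rw [conjTranspose_nonsing_inv, hH.eq]
  rw [pinv, conjTranspose_mul, conjTranspose_conjTranspose, hHi]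
  simp only [Matrix.mul_assoc]

/-- [folklore] **THE `V`-CORNER KILLS THE COLUMNS FROM THE LEFT AND `ker Xᴴ` FROM THE RIGHT**: `Xᴴ·(R·H⁻¹·V·P) = 0` and
`(R·H⁻¹·V·P)·R = 0` — recorded for the A3 bookkeeping (each jet term is `R`-left/`P`-right or its adjoint). -/
theorem corner_mul_coproj {X : Matrix n m 𝕜} (hG : IsUnit (Xᴴ * X)) (M : Matrix n n 𝕜) :
    coproj X * M * (1 - coproj X) * coproj X = 0 ∧ Xᴴ * (coproj X * M * (1 - coproj X)) = 0 := by
  constructor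
  · rw [Matrix.mul_assoc, Matrix.sub_mul, Matrix.one_mul, coproj_mul_coproj hG, sub_self, Matrix.mul_zero]
  · rw [← Matrix.mul_assoc, ← Matrix.mul_assoc, conjTranspose_mul_coproj hG, Matrix.zero_mul, Matrix.zero_mul]

end Algebra

end Summit.QuantumFields.BalabanUV.Beta.D1BFx.ProjectorJet
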